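import Literature.RepresentationTheory.FiniteGroups.SymmetricGroupHookCharacters
import Literature.NumberTheory.DiophantineGeometry.SymmetricGroupCharacterSums
import Mathlib.GroupTheory.Perm.Cycle.Type
import HarnessLib

/-!
# The four-term class functions of `𝔖_n` (Landsberg–Manivel–Ressayre 2013, §3.4): `dim C_n = 2`

Topic `Literature/RepresentationTheory/FiniteGroups`. Cell `val-lit`, row `LMR13-A`, item (X4)
(val-lit-p8 g3). Honest framing: the COMBINATORIAL CORE of the proof of LMR 2013 Prop. 3.4.2
(`P_n = {1ⁿ, 21^{n−2}}`); typed literature, VP ≠ VNP is NOT proved and nothing here is progress on it.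

LMR 2013, proof of Prop. 3.4.2 (journal p. 480; arXiv 1004.4802 p. 9): "it is enough to check that
the vector space `C_n` of class functions `F` on `𝔖_n`, such that `∑_{τ ∈ ⟨(ij),(kl)⟩} F(στ) = 0`
`∀σ, ∀i, j, k, l`, is at most two-dimensional. We prove that `F ∈ C_n` is completely determined by
its values on permutations of cycle type `(1ⁿ)` or `(21^{n−2})` … Apply induction on the number of
fixed points in `σ`. Suppose that `σ` has at least two nontrivial cycles. Choose `i` and `k` in these
two cycles and let `j = σ(i)`, `l = σ(k)`, then the three permutations `σ(ij), σ(kl), σ(ij)(kl)` have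
more fixed points than `σ`. If `σ` has a cycle of length at least four, take `i` in this cycle and
let `j = σ(i)`, `k = σ(j)`, `l = σ(k)`, to obtain the same conclusion. Finally, if `σ` is of cycle
type `31^{n−3}` … `2F(31^{n−3}) + F(41^{n−4}) + F(21^{n−2}) = 0` … `F(41^{n−4}) + F(221^{n−4}) = 0`
… `F(221^{n−4}) + 2F(21^{n−2}) + F(1ⁿ) = 0`. These three identities altogether imply that
`F(31^{n−3})` is determined by `F(21^{n−2})` and `F(1ⁿ)`, and then the induction argument shows that
`F` is completely determined by these two values."

CONVENTION (checked, see `sign_mem`, `signMulFixSubOne_mem` and `rel_threeCycle` below): the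
relation is the PLAIN sum over the Klein four-group `⟨(ij),(kl)⟩`,
`F σ + F (σ(ij)) + F (σ(kl)) + F (σ(ij)(kl)) = 0` for `i, j, k, l` pairwise distinct. Both known
members of `C_n` satisfy it: `sgn` gives `sgn σ · (1 − 1 − 1 + 1) = 0`, and `sgn·(#fix − 1)` gives
`sgn σ · (#fix σ − #fix σ(ij) − #fix σ(kl) + #fix σ(ij)(kl)) = 0` point by point; and with it the three
printed relations come out exactly as printed (e.g. at the `3`-cycle `(123)` with `ijkl = 1234`:
`σ(12) = (13)`, `σ(34) = (1234)`, `σ(12)(34) = (134)`, whence `2F(31^{n−3}) + F(41^{n−4}) + F(21^{n−2})`).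

Contents (`n ≥ 4` where stated; for `n ≤ 3` there are no four distinct indices, `C_n` is the space of
all class functions and the printed argument does not apply):

* `fourTermClassFunctions n : Submodule ℂ (Equiv.Perm (Fin n) → ℂ)` — the space `C_n` (the one
  definition of this file);
* `sign_mem`, `signMulFixSubOne_mem` — `sgn ∈ C_n` and `sgn·(#fix − 1) ∈ C_n` (the characters
  `χ^{(1ⁿ)}`, `χ^{(2,1^{n−2})}`, `SymmetricGroupHookCharacters.lean`);
* `eq_zero_of_mem_of_apply_one_of_apply_swap` — **`F ∈ C_n`, `F(1) = 0`, `F((ab)) = 0` ⇒ `F = 0`**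
  (`n ≥ 4`; LMR's induction, run on the size of the support);
* `finrank_fourTermClassFunctions` — **`dim C_n = 2`** (`n ≥ 4`);
* `spechtCharacter_mem_fourTermClassFunctions_iff` — for `n ≥ 4`, **`χ^λ ∈ C_n ↔ λ = (1ⁿ) ∨
  λ = (2,1^{n−2})`** (by the parts), using the linear independence of the irreducible characters
  (`linearIndependent_spechtCharacter`, `SymmetricGroupCharacterSums.lean`).

With LMR Lemma 3.4.1 (`IM_λ ∈ T̂_{[det_n]}𝒟ual ⇒ χ_λ ∈ C_n`, not in the tree: it needs the
first-order identity of §3.3 and Lemma 3.3.2) the last statement is the `⊆` half of the named fact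
`LMR2013_prop_3_4_2` for `n ≥ 4` (its `⊇` half is `LMR2013_prop_3_4_2_mpr`, `AC/LMR13ImmanantsTangent.lean`).

## References
* [LandsbergManivelRessayre2013] J. M. Landsberg, L. Manivel, N. Ressayre, *Hypersurfaces with
  degenerate duals and the Geometric Complexity Theory Program*, Comment. Math. Helv. 88 (2013)
  469–484, §3.4: Lemma 3.4.1 and Proposition 3.4.2 with its proof (pp. 479–480).
* [FultonHarrisGTM129] W. Fulton, J. Harris, *Representation Theory*, GTM 129, Thm. 2.12 with Thm. 4.3
  (linear independence of the irreducible characters), §4.1, Exercise 4.6 (the two characters).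

## Mathlib and tree
Mathlib: `Equiv.Perm.support`, `Equiv.Perm.card_support_swap_mul`, `Equiv.Perm.mul_swap_eq_swap_mul`,
`Equiv.Perm.isConj_swap`, `Equiv.Perm.isConj_iff_cycleType_eq`, `Equiv.Perm.cycleType_inv`,
`Equiv.Perm.isThreeCycle_swap_mul_swap_same`, `Equiv.Perm.disjoint_swap_swap`,
`LinearIndependent.pair_iff`, `LinearIndependent.fintype_card_le_finrank`,
`LinearMap.finrank_le_finrank_of_injective`; the tactic `grind` for the pointwise evaluation of
products of transpositions. Tree: `spechtCharacter_of_parts_eq_replicate_one`,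
`spechtCharacter_of_parts_eq_two_cons_replicate_one` (`SymmetricGroupHookCharacters.lean`),
`linearIndependent_spechtCharacter` (`SymmetricGroupCharacterSums.lean`).
-/

noncomputable section

namespace Literature.RepresentationTheory.FiniteGroups

open Equiv Equiv.Perm
open _root_.Literature.NumberTheory.DiophantineGeometry (spechtCharacter)

variable {n : ℕ}

/-! ### The space `C_n` -/

section Space

/-- **The space `C_n` of four-term class functions** (LMR 2013, proof of Prop. 3.4.2, p. 480): the
class functions `F : 𝔖_n → ℂ` with `∑_{τ ∈ ⟨(ij),(kl)⟩} F(στ) = 0` for every `σ` and every four-tuple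
of pairwise distinct indices `i, j, k, l` — written out, `F σ + F (σ(ij)) + F (σ(kl)) + F (σ(ij)(kl)) = 0`
(the plain sum over the Klein four-group generated by the disjoint transpositions `(ij)`, `(kl)`).
[cite: LandsbergManivelRessayre2013, Proposition 3.4.2 (proof, p. 480)] -/
def fourTermClassFunctions (n : ℕ) : Submodule ℂ (Equiv.Perm (Fin n) → ℂ) where
  carrier := {F | (∀ σ τ : Equiv.Perm (Fin n), F (τ * σ * τ⁻¹) = F σ) ∧
    ∀ (σ : Equiv.Perm (Fin n)) (i j k l : Fin n), i ≠ j → k ≠ l → i ≠ k → i ≠ l → j ≠ k → j ≠ l →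
      F σ + F (σ * swap i j) + F (σ * swap k l) + F (σ * swap i j * swap k l) = 0}
  zero_mem' := ⟨fun _ _ => rfl, fun _ _ _ _ _ _ _ _ _ _ _ => by simp⟩
  add_mem' := by
    rintro F G ⟨hF₁, hF₂⟩ ⟨hG₁, hG₂⟩
    refine ⟨fun σ τ => by simp only [Pi.add_apply, hF₁, hG₁], fun σ i j k l h₁ h₂ h₃ h₄ h₅ h₆ => ?_⟩
    have hF := hF₂ σ i j k l h₁ h₂ h₃ h₄ h₅ h₆
    have hG := hG₂ σ i j k l h₁ h₂ h₃ h₄ h₅ h₆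
    simp only [Pi.add_apply]
    linear_combination hF + hG
  smul_mem' := by
    rintro c F ⟨hF₁, hF₂⟩
    refine ⟨fun σ τ => by simp only [Pi.smul_apply, hF₁], fun σ i j k l h₁ h₂ h₃ h₄ h₅ h₆ => ?_⟩
    have hF := hF₂ σ i j k l h₁ h₂ h₃ h₄ h₅ h₆
    simp only [Pi.smul_apply, smul_eq_mul]
    linear_combination c * hF

/-- Membership in `C_n`, unfolded. [cite: LandsbergManivelRessayre2013, Proposition 3.4.2 (proof, p. 480)] -/
theorem mem_fourTermClassFunctions_iff {F : Equiv.Perm (Fin n) → ℂ} :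
    F ∈ fourTermClassFunctions n ↔ (∀ σ τ : Equiv.Perm (Fin n), F (τ * σ * τ⁻¹) = F σ) ∧
      ∀ (σ : Equiv.Perm (Fin n)) (i j k l : Fin n), i ≠ j → k ≠ l → i ≠ k → i ≠ l → j ≠ k → j ≠ l →
        F σ + F (σ * swap i j) + F (σ * swap k l) + F (σ * swap i j * swap k l) = 0 :=
  Iff.rfl

/-- A member of `C_n` is constant on conjugacy classes. [cite: LandsbergManivelRessayre2013, Proposition 3.4.2 (proof, p. 480)] -/
theorem apply_eq_of_isConj {F : Equiv.Perm (Fin n) → ℂ} (hF : F ∈ fourTermClassFunctions n)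
    {σ ρ : Equiv.Perm (Fin n)} (h : IsConj σ ρ) : F σ = F ρ := by
  obtain ⟨c, hc⟩ := isConj_iff.1 h
  rw [← hc, hF.1]

/-- The four-term relation of a member of `C_n`, solved for `F σ`.
[cite: LandsbergManivelRessayre2013, Proposition 3.4.2 (proof, p. 480)] -/
theorem apply_eq_neg_of_mem {F : Equiv.Perm (Fin n) → ℂ} (hF : F ∈ fourTermClassFunctions n)
    (σ : Equiv.Perm (Fin n)) {i j k l : Fin n} (hij : i ≠ j) (hkl : k ≠ l) (hik : i ≠ k) (hil : i ≠ l)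
    (hjk : j ≠ k) (hjl : j ≠ l) :
    F σ = -(F (σ * swap i j) + F (σ * swap k l) + F (σ * swap i j * swap k l)) := by
  linear_combination hF.2 σ i j k l hij hkl hik hil hjk hjl

end Space

/-! ### The two known members: `sgn` and `sgn · (#fix − 1)` -/

section Members

/-- The sign character as a complex class function. [cite: FultonHarrisGTM129, §4.1] -/
theorem sign_conj_cast (σ τ : Equiv.Perm (Fin n)) :
    (((Equiv.Perm.sign (τ * σ * τ⁻¹) : ℤˣ) : ℤ) : ℂ) = ((Equiv.Perm.sign σ : ℤ) : ℂ) := by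
  rw [Equiv.Perm.sign_mul, Equiv.Perm.sign_mul, Equiv.Perm.sign_inv, mul_right_comm, ← sq,
    Int.units_sq, one_mul]

/-- `sgn(σ (ij)) = −sgn σ` as complex numbers. [cite: FultonHarrisGTM129, §4.1] -/
theorem sign_mul_swap_cast (σ : Equiv.Perm (Fin n)) {i j : Fin n} (hij : i ≠ j) :
    (((Equiv.Perm.sign (σ * swap i j) : ℤˣ) : ℤ) : ℂ) = -((Equiv.Perm.sign σ : ℤ) : ℂ) := by
  rw [Equiv.Perm.sign_mul, Equiv.Perm.sign_swap hij, mul_neg, mul_one, Units.val_neg, Int.cast_neg]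

/-- **`sgn ∈ C_n`**: `sgn σ · (1 − 1 − 1 + 1) = 0`. [cite: LandsbergManivelRessayre2013, Proposition 3.4.2 (proof, p. 480)] -/
theorem sign_mem :
    (fun σ : Equiv.Perm (Fin n) => ((Equiv.Perm.sign σ : ℤ) : ℂ)) ∈ fourTermClassFunctions n := by
  refine ⟨fun σ τ => sign_conj_cast σ τ, fun σ i j k l hij hkl _ _ _ _ => ?_⟩
  simp only [sign_mul_swap_cast _ hkl, sign_mul_swap_cast _ hij]
  ring

/-- The number of fixed points is a class function. [cite: FultonHarrisGTM129, Exercise 4.6] -/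
theorem card_filter_fixed_conj (σ τ : Equiv.Perm (Fin n)) :
    (Finset.univ.filter fun p : Fin n => (τ * σ * τ⁻¹) p = p).card =
      (Finset.univ.filter fun p : Fin n => σ p = p).card := by
  symm
  refine Finset.card_equiv (τ : Fin n ≃ Fin n) fun p => ?_
  simp only [Finset.mem_filter, Finset.mem_univ, true_and, Perm.mul_apply, Perm.coe_inv,
    Equiv.symm_apply_apply]
  exact τ.injective.eq_iff.symm

/-- **The fixed-point count over the Klein four-group `⟨(ij),(kl)⟩` balances**:
`#fix σ + #fix σ(ij)(kl) = #fix σ(ij) + #fix σ(kl)` — point by point, a point outside `{i,j,k,l}`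
contributes equally to all four terms, a point of `{i,j}` (resp. `{k,l}`) contributes equally to
`σ, σ(kl)` and to `σ(ij), σ(ij)(kl)` (resp. to `σ, σ(ij)` and to `σ(kl), σ(ij)(kl)`).
[cite: LandsbergManivelRessayre2013, Proposition 3.4.2 (proof, p. 480)] -/
theorem card_filter_fixed_four_term (σ : Equiv.Perm (Fin n)) {i j k l : Fin n} (hik : i ≠ k)
    (hil : i ≠ l) (hjk : j ≠ k) (hjl : j ≠ l) :
    (Finset.univ.filter fun p : Fin n => σ p = p).card +
        (Finset.univ.filter fun p : Fin n => (σ * swap i j * swap k l) p = p).card =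
      (Finset.univ.filter fun p : Fin n => (σ * swap i j) p = p).card +
        (Finset.univ.filter fun p : Fin n => (σ * swap k l) p = p).card := by
  classical
  simp only [Finset.card_filter, ← Finset.sum_add_distrib]
  refine Finset.sum_congr rfl fun p _ => ?_
  simp only [Perm.mul_apply]
  grind

/-- **`sgn · (#fix − 1) ∈ C_n`** (the character `χ^{(2,1^{n−2})}`).
[cite: LandsbergManivelRessayre2013, Proposition 3.4.2 (proof, p. 480)] -/
theorem signMulFixSubOne_mem :
    (fun σ : Equiv.Perm (Fin n) => ((Equiv.Perm.sign σ : ℤ) : ℂ) *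
        (((Finset.univ.filter fun p : Fin n => σ p = p).card : ℂ) - 1)) ∈
      fourTermClassFunctions n := by
  refine ⟨fun σ τ => by simp only [sign_conj_cast, card_filter_fixed_conj],
    fun σ i j k l hij hkl hik hil hjk hjl => ?_⟩
  have hfix := card_filter_fixed_four_term σ (i := i) (j := j) hik hil hjk hjl
  have hcast : ((Finset.univ.filter fun p : Fin n => σ p = p).card : ℂ) +
      ((Finset.univ.filter fun p : Fin n => (σ * swap i j * swap k l) p = p).card : ℂ) =
      ((Finset.univ.filter fun p : Fin n => (σ * swap i j) p = p).card : ℂ) +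
        ((Finset.univ.filter fun p : Fin n => (σ * swap k l) p = p).card : ℂ) := by
    exact_mod_cast hfix
  simp only [sign_mul_swap_cast _ hkl, sign_mul_swap_cast _ hij, neg_neg]
  linear_combination ((Equiv.Perm.sign σ : ℤ) : ℂ) * hcast

end Members

/-! ### `F ∈ C_n` vanishing at `1` and at a transposition vanishes identically (`n ≥ 4`) -/

section Vanishing

variable {F : Equiv.Perm (Fin n) → ℂ}

/-- All transpositions are conjugate, so `F` takes one value on them.
[cite: LandsbergManivelRessayre2013, Proposition 3.4.2 (proof, p. 480)] -/
theorem apply_swap_eq_zero (hF : F ∈ fourTermClassFunctions n) {a b : Fin n} (hab : a ≠ b)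
    (h2 : F (swap a b) = 0) {x y : Fin n} (hxy : x ≠ y) : F (swap x y) = 0 := by
  rw [apply_eq_of_isConj hF (isConj_swap hxy hab), h2]

/-- Cycle type `221^{n−4}`: the relation at `σ = (ab)(cd)` with `ijkl = abcd` reads
`F(221^{n−4}) + 2F(21^{n−2}) + F(1ⁿ) = 0`. [cite: LandsbergManivelRessayre2013, Proposition 3.4.2 (proof, p. 480)] -/
theorem rel_twoTwo (hF : F ∈ fourTermClassFunctions n) {a b c d : Fin n} (hab : a ≠ b) (hac : a ≠ c)
    (had : a ≠ d) (hbc : b ≠ c) (hbd : b ≠ d) (hcd : c ≠ d) :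
    F (swap a b * swap c d) + F (swap c d) + F (swap a b) + F 1 = 0 := by
  have hcomm : swap a b * swap c d = swap c d * swap a b :=
    (disjoint_swap_swap (by simp [hab, hac, had, hbc, hbd, hcd])).commute.eq
  have h := hF.2 (swap a b * swap c d) a b c d hab hcd hac had hbc hbd
  have e1 : swap a b * swap c d * swap a b = swap c d := by
    rw [hcomm, mul_assoc, swap_mul_self, mul_one]
  have e2 : swap a b * swap c d * swap c d = swap a b := by rw [mul_assoc, swap_mul_self, mul_one]
  have e3 : swap a b * swap c d * swap a b * swap c d = 1 := by rw [e1, swap_mul_self]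
  rwa [e3, e1, e2] at h

/-- Hence `F((ab)(cd)) = 0` when `F(1) = F((ab)) = 0`.
[cite: LandsbergManivelRessayre2013, Proposition 3.4.2 (proof, p. 480)] -/
theorem apply_twoTwo_eq_zero (hF : F ∈ fourTermClassFunctions n) (h1 : F 1 = 0) {a₀ b₀ : Fin n}
    (hab₀ : a₀ ≠ b₀) (h2 : F (swap a₀ b₀) = 0) {a b c d : Fin n} (hab : a ≠ b) (hac : a ≠ c)
    (had : a ≠ d) (hbc : b ≠ c) (hbd : b ≠ d) (hcd : c ≠ d) : F (swap a b * swap c d) = 0 := by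
  have h := rel_twoTwo hF hab hac had hbc hbd hcd
  rw [apply_swap_eq_zero hF hab₀ h2 hcd, apply_swap_eq_zero hF hab₀ h2 hab, h1] at h
  simpa using h

/-- Cycle type `41^{n−4}`: for the `4`-cycle `a ↦ b ↦ c ↦ d ↦ a` and `ijkl = acbd` one finds
`σ(ac) = (ad)(bc)`, `σ(bd) = (ab)(cd)` and `σ(ac)(bd) = σ⁻¹`, so the relation reads
`F(41^{n−4}) + F(221^{n−4}) = 0` (twice). [cite: LandsbergManivelRessayre2013, Proposition 3.4.2 (proof, p. 480)] -/
theorem apply_fourCycle_eq_zero (hF : F ∈ fourTermClassFunctions n) (h1 : F 1 = 0) {a₀ b₀ : Fin n}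
    (hab₀ : a₀ ≠ b₀) (h2 : F (swap a₀ b₀) = 0) {σ : Equiv.Perm (Fin n)} {a b c d : Fin n}
    (hab : a ≠ b) (hac : a ≠ c) (had : a ≠ d) (hbc : b ≠ c) (hbd : b ≠ d) (hcd : c ≠ d)
    (ha : σ a = b) (hb : σ b = c) (hc : σ c = d) (hd : σ d = a)
    (hfix : ∀ p, p ≠ a → p ≠ b → p ≠ c → p ≠ d → σ p = p) : F σ = 0 := by
  have e1 : σ * swap a c = swap a d * swap b c := by
    ext x
    simp only [Perm.mul_apply]
    grind
  have e2 : σ * swap b d = swap a b * swap c d := by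
    ext x
    simp only [Perm.mul_apply]
    grind
  have e3 : σ * swap a c * swap b d = σ⁻¹ := by
    rw [eq_inv_iff_mul_eq_one]
    ext x
    simp only [Perm.mul_apply, Perm.one_apply]
    grind
  have hinv : F σ⁻¹ = F σ :=
    apply_eq_of_isConj hF (isConj_iff_cycleType_eq.2 (cycleType_inv σ))
  have h := apply_eq_neg_of_mem hF σ hac hbd hab had hbc.symm hcd
  rw [e3, e1, e2, hinv, apply_twoTwo_eq_zero hF h1 hab₀ h2 had hab hac hbd.symm hcd.symm hbc,
    apply_twoTwo_eq_zero hF h1 hab₀ h2 hab hac had hbc hbd hcd] at h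
  linear_combination h / 2

/-- Cycle type `31^{n−3}` (`n ≥ 4`): for the `3`-cycle `a ↦ b ↦ c ↦ a`, a fourth index `d` and
`ijkl = abcd` one finds `σ(ab) = (ac)`, `σ(cd) =` the `4`-cycle `a ↦ b ↦ c ↦ d ↦ a` and
`σ(ab)(cd) =` the `3`-cycle `a ↦ c ↦ d ↦ a`, so the relation reads
`2F(31^{n−3}) + F(41^{n−4}) + F(21^{n−2}) = 0`. [cite: LandsbergManivelRessayre2013, Proposition 3.4.2 (proof, p. 480)] -/
theorem apply_threeCycle_eq_zero (hF : F ∈ fourTermClassFunctions n) (h1 : F 1 = 0) {a₀ b₀ : Fin n}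
    (hab₀ : a₀ ≠ b₀) (h2 : F (swap a₀ b₀) = 0) {σ : Equiv.Perm (Fin n)} {a b c d : Fin n}
    (hab : a ≠ b) (hac : a ≠ c) (had : a ≠ d) (hbc : b ≠ c) (hbd : b ≠ d) (hcd : c ≠ d)
    (ha : σ a = b) (hb : σ b = c) (hc : σ c = a) (hfix : ∀ p, p ≠ a → p ≠ b → p ≠ c → σ p = p) :
    F σ = 0 := by
  have hd : σ d = d := hfix d had.symm hbd.symm hcd.symm
  have e0 : σ = swap a c * swap a b := by
    ext x
    simp only [Perm.mul_apply]
    grind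
  have e1 : σ * swap a b = swap a c := by
    rw [e0, mul_assoc, swap_mul_self, mul_one]
  -- `σ(cd)` is the `4`-cycle `a ↦ b ↦ c ↦ d ↦ a`
  have e2 : F (σ * swap c d) = 0 := by
    refine apply_fourCycle_eq_zero hF h1 hab₀ h2 (σ := σ * swap c d) hab hac had hbc hbd hcd
      ?_ ?_ ?_ ?_ fun p hpa hpb hpc hpd => ?_
    · rw [Perm.mul_apply, swap_apply_of_ne_of_ne hac had, ha]
    · rw [Perm.mul_apply, swap_apply_of_ne_of_ne hbc hbd, hb]
    · rw [Perm.mul_apply, swap_apply_left, hd]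
    · rw [Perm.mul_apply, swap_apply_right, hc]
    · rw [Perm.mul_apply, swap_apply_of_ne_of_ne hpc hpd, hfix p hpa hpb hpc]
  -- `σ(ab)(cd)` is the `3`-cycle `a ↦ c ↦ d ↦ a`, conjugate to `σ`
  have e3 : σ * swap a b * swap c d = swap a d * swap a c := by
    rw [e1]
    ext x
    simp only [Perm.mul_apply]
    grind
  have hconj : F (σ * swap a b * swap c d) = F σ := by
    refine apply_eq_of_isConj hF (isConj_iff_cycleType_eq.2 ?_)
    rw [e3, e0, (isThreeCycle_swap_mul_swap_same had hac hcd.symm).cycleType,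
      (isThreeCycle_swap_mul_swap_same hac hab hbc.symm).cycleType]
  have h := apply_eq_neg_of_mem hF σ hab hcd hac had hbc hbd
  rw [hconj, e2, e1, apply_swap_eq_zero hF hab₀ h2 hac] at h
  linear_combination h / 2

/-- **A four-term class function vanishing at the identity and at a transposition vanishes
identically** (`n ≥ 4`) — LMR's induction: if `σ` moves `i` and `k` with `i, σ(i), k, σ(k)`
pairwise distinct, the three permutations `σ(iσ(i))`, `σ(kσ(k))`, `σ(iσ(i))(kσ(k))` have smaller
support, which disposes of every `σ` with two nontrivial cycles or a cycle of length `≥ 4`; the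
transpositions are conjugate; and the `3`-cycles are `apply_threeCycle_eq_zero`.
[cite: LandsbergManivelRessayre2013, Proposition 3.4.2 (proof, p. 480)] -/
theorem eq_zero_of_mem_of_apply_one_of_apply_swap (hn : 4 ≤ n) (hF : F ∈ fourTermClassFunctions n)
    (h1 : F 1 = 0) {a₀ b₀ : Fin n} (hab₀ : a₀ ≠ b₀) (h2 : F (swap a₀ b₀) = 0) : F = 0 := by
  classical
  funext σ
  rw [Pi.zero_apply]
  induction hm : σ.support.card using Nat.strong_induction_on generalizing σ with
  | _ m ih =>
  subst hm
  by_cases hσ1 : σ = 1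
  · rw [hσ1, h1]
  obtain ⟨i, hi⟩ : ∃ i, σ i ≠ i := by
    by_contra hall
    push Not at hall
    exact hσ1 (Equiv.ext hall)
  -- the reduction step: `i, σ i, k, σ k` pairwise distinct
  have reduce : ∀ k, σ k ≠ k → k ≠ i → k ≠ σ i → σ k ≠ i → F σ = 0 := by
    intro k hk hki hkj hki'
    have hij : i ≠ σ i := fun h => hi h.symm
    have hkl : k ≠ σ k := fun h => hk h.symm
    have hjl : σ i ≠ σ k := fun h => hki (σ.injective h).symm
    have hσj : σ (σ i) ≠ σ i := fun h => hi (σ.injective h)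
    have hσl : σ (σ k) ≠ σ k := fun h => hk (σ.injective h)
    -- the three permutations have smaller support
    have c1 : (σ * swap i (σ i)).support.card < σ.support.card := by
      rw [mul_swap_eq_swap_mul]
      exact card_support_swap_mul hσj
    have c2 : (σ * swap k (σ k)).support.card < σ.support.card := by
      rw [mul_swap_eq_swap_mul]
      exact card_support_swap_mul hσl
    have c3 : (σ * swap i (σ i) * swap k (σ k)).support.card < σ.support.card := by
      set σ' := σ * swap i (σ i) with hσ'
      have hk' : σ' k = σ k := by
        rw [hσ', Perm.mul_apply, swap_apply_of_ne_of_ne hki hkj]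
      have hl' : σ' (σ k) = σ (σ k) := by
        rw [hσ', Perm.mul_apply, swap_apply_of_ne_of_ne hki' hjl.symm]
      have hσ'l : σ' (σ' k) ≠ σ' k := by rw [hk', hl']; exact hσl
      have := card_support_swap_mul hσ'l
      rw [← mul_swap_eq_swap_mul, hk'] at this
      exact this.trans c1
    rw [apply_eq_neg_of_mem hF σ hij hkl hki.symm hki'.symm hkj.symm hjl,
      ih _ c1 _ rfl, ih _ c2 _ rfl, ih _ c3 _ rfl]
    simp
  by_cases h2c : σ (σ i) = i
  · -- `(i σi)` is a `2`-cycle of `σ`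
    by_cases hrest : ∃ p, p ≠ i ∧ p ≠ σ i ∧ σ p ≠ p
    · obtain ⟨p, hpi, hpj, hp⟩ := hrest
      exact reduce p hp hpi hpj fun h => hpj (σ.injective (h.trans h2c.symm))
    · push Not at hrest
      have hσ : σ = swap i (σ i) := by
        ext x
        by_cases hxi : x = i
        · rw [hxi, swap_apply_left]
        · by_cases hxj : x = σ i
          · rw [hxj, swap_apply_right, h2c]
          · rw [swap_apply_of_ne_of_ne hxi hxj, hrest x hxi hxj]
      rw [hσ]
      exact apply_swap_eq_zero hF hab₀ h2 fun h => hi h.symm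
  · have hk : σ (σ (σ i)) ≠ σ (σ i) := fun h => hi (σ.injective (σ.injective h))
    have hkj : σ (σ i) ≠ σ i := fun h => hi (σ.injective h)
    by_cases h3c : σ (σ (σ (σ i))) = σ i
    · -- the cycle of `i` is the `3`-cycle `(i, σ i, σ² i)`
      have h3 : σ (σ (σ i)) = i := σ.injective h3c
      by_cases hrest : ∃ p, p ≠ i ∧ p ≠ σ i ∧ p ≠ σ (σ i) ∧ σ p ≠ p
      · obtain ⟨p, hpi, hpj, hpk, hp⟩ := hrest
        exact reduce p hp hpi hpj fun h => hpk (σ.injective (h.trans h3.symm))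
      · push Not at hrest
        -- a fourth index
        obtain ⟨d, -, hd⟩ : ∃ d ∈ (Finset.univ : Finset (Fin n)),
            d ∉ ({i, σ i, σ (σ i)} : Finset (Fin n)) :=
          Finset.exists_mem_notMem_of_card_lt_card
            (lt_of_le_of_lt Finset.card_le_three (by rw [Finset.card_univ, Fintype.card_fin]; omega))
        simp only [Finset.mem_insert, Finset.mem_singleton, not_or] at hd
        exact apply_threeCycle_eq_zero hF h1 hab₀ h2 (σ := σ) (a := i) (b := σ i) (c := σ (σ i))
          (d := d) (fun h => hi h.symm) (fun h => h2c h.symm) (Ne.symm hd.1) hkj.symm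
          (Ne.symm hd.2.1) (Ne.symm hd.2.2) rfl rfl h3 fun p hpa hpb hpc => hrest p hpa hpb hpc
    · -- the cycle of `i` has length `≥ 4`
      exact reduce (σ (σ i)) hk (fun h => h2c h) hkj fun h => h3c (congrArg σ h)

end Vanishing

/-! ### `dim C_n = 2` and the characters in `C_n` -/

section Dimension

/-- A transposition has `n − 2` fixed points. [cite: FultonHarrisGTM129, Exercise 4.6] -/
theorem card_filter_fixed_swap {a b : Fin n} (hab : a ≠ b) :
    (Finset.univ.filter fun p : Fin n => swap a b p = p).card = n - 2 := by
  classical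
  have h : (Finset.univ.filter fun p : Fin n => swap a b p = p) = (swap a b).supportᶜ := by
    ext p
    simp [Perm.mem_support]
  rw [h, Finset.card_compl, card_support_swap hab, Fintype.card_fin]

/-- The identity has `n` fixed points. [cite: FultonHarrisGTM129, Exercise 4.6] -/
theorem card_filter_fixed_one :
    (Finset.univ.filter fun p : Fin n => (1 : Equiv.Perm (Fin n)) p = p).card = n := by
  simp

/-- **`dim C_n = 2` for `n ≥ 4`** ("the vector space `C_n` … is at most two-dimensional", and it
contains the two independent functions `sgn`, `sgn·(#fix − 1)`).
[cite: LandsbergManivelRessayre2013, Proposition 3.4.2 (proof, p. 480)] -/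
theorem finrank_fourTermClassFunctions (hn : 4 ≤ n) :
    Module.finrank ℂ (fourTermClassFunctions n) = 2 := by
  classical
  have h0 : (0 : ℕ) < n := by omega
  have h1 : (1 : ℕ) < n := by omega
  have hab : (⟨0, h0⟩ : Fin n) ≠ ⟨1, h1⟩ := by simp [Fin.ext_iff]
  apply le_antisymm
  · -- evaluation at `1` and at the transposition `(01)` is injective on `C_n`
    let ev : fourTermClassFunctions n →ₗ[ℂ] (Fin 2 → ℂ) :=
      { toFun := fun F => ![F.1 1, F.1 (swap ⟨0, h0⟩ ⟨1, h1⟩)]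
        map_add' := fun F G => by
          ext t; fin_cases t <;> simp
        map_smul' := fun c F => by
          ext t; fin_cases t <;> simp }
    have hinj : Function.Injective ev := by
      intro F G hFG
      have e0 : F.1 1 = G.1 1 := by simpa [ev] using congrFun hFG 0
      have e1 : F.1 (swap ⟨0, h0⟩ ⟨1, h1⟩) = G.1 (swap ⟨0, h0⟩ ⟨1, h1⟩) := by
        simpa [ev] using congrFun hFG 1
      apply Subtype.ext
      have hdiff : (F - G).1 = 0 := by
        refine eq_zero_of_mem_of_apply_one_of_apply_swap hn (F - G).2 ?_ hab ?_
        · rw [Submodule.coe_sub, Pi.sub_apply, e0, sub_self]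
        · rw [Submodule.coe_sub, Pi.sub_apply, e1, sub_self]
      exact sub_eq_zero.1 hdiff
    have := LinearMap.finrank_le_finrank_of_injective hinj
    simpa using this
  · -- `sgn`, `sgn·(#fix − 1)` are independent members
    set χ₁ : fourTermClassFunctions n := ⟨_, sign_mem⟩ with hχ₁
    set χ₂ : fourTermClassFunctions n := ⟨_, signMulFixSubOne_mem⟩ with hχ₂
    have hv : LinearIndependent ℂ ![χ₁, χ₂] := by
      refine LinearIndependent.pair_iff.2 fun s t hst => ?_
      have e : ∀ σ : Equiv.Perm (Fin n), s * ((Equiv.Perm.sign σ : ℤ) : ℂ) +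
          t * (((Equiv.Perm.sign σ : ℤ) : ℂ) *
            (((Finset.univ.filter fun p : Fin n => σ p = p).card : ℂ) - 1)) = 0 := by
        intro σ
        have := congrFun (congrArg Subtype.val hst) σ
        simpa [hχ₁, hχ₂] using this
      have e1 := e 1
      have e2 := e (swap ⟨0, h0⟩ ⟨1, h1⟩)
      rw [card_filter_fixed_one, Equiv.Perm.sign_one] at e1
      rw [card_filter_fixed_swap hab, Equiv.Perm.sign_swap hab, Nat.cast_sub (by omega : 2 ≤ n)] at e2
      simp only [Units.val_one, Int.cast_one, Units.val_neg, Int.cast_neg, Nat.cast_ofNat] at e1 e2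
      have ht : t = 0 := by linear_combination (e1 + e2) / 2
      subst ht
      exact ⟨by linear_combination e1, rfl⟩
    have := hv.fintype_card_le_finrank
    simpa using this

/-- **The irreducible characters in `C_n` are exactly `χ^{(1ⁿ)}` and `χ^{(2,1^{n−2})}`** (`n ≥ 4`):
they do lie in `C_n` (`sign_mem`, `signMulFixSubOne_mem`, and the character values), and a third
irreducible character in the `2`-dimensional space `C_n` would contradict the linear independence of
the irreducible characters. With LMR Lemma 3.4.1 this is Prop. 3.4.2, `P_n ⊆ {1ⁿ, 21^{n−2}}`.
[cite: LandsbergManivelRessayre2013, Proposition 3.4.2 (p. 479)] -/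
theorem spechtCharacter_mem_fourTermClassFunctions_iff (hn : 4 ≤ n) (lam : Nat.Partition n) :
    spechtCharacter ℂ lam ∈ fourTermClassFunctions n ↔
      lam.parts = Multiset.replicate n 1 ∨ lam.parts = 2 ::ₘ Multiset.replicate (n - 2) 1 := by
  classical
  -- the two partitions `(1ⁿ)`, `(2,1^{n−2})`
  obtain ⟨μ₁, hμ₁⟩ : ∃ μ : Nat.Partition n, μ.parts = Multiset.replicate n 1 :=
    ⟨⟨Multiset.replicate n 1, fun h => by rw [Multiset.eq_of_mem_replicate h]; norm_num, by simp⟩, rfl⟩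
  obtain ⟨μ₂, hμ₂⟩ : ∃ μ : Nat.Partition n, μ.parts = 2 ::ₘ Multiset.replicate (n - 2) 1 := by
    refine ⟨⟨2 ::ₘ Multiset.replicate (n - 2) 1, fun h => ?_, ?_⟩, rfl⟩
    · rcases Multiset.mem_cons.1 h with h | h
      · omega
      · rw [Multiset.eq_of_mem_replicate h]; norm_num
    · rw [Multiset.sum_cons, Multiset.sum_replicate, smul_eq_mul, mul_one]; omega
  have hcol : spechtCharacter ℂ μ₁ = fun σ : Equiv.Perm (Fin n) => ((Equiv.Perm.sign σ : ℤ) : ℂ) :=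
    funext fun σ => spechtCharacter_of_parts_eq_replicate_one μ₁ hμ₁ σ
  have hhook : spechtCharacter ℂ μ₂ = fun σ : Equiv.Perm (Fin n) => ((Equiv.Perm.sign σ : ℤ) : ℂ) *
      (((Finset.univ.filter fun p : Fin n => σ p = p).card : ℂ) - 1) :=
    funext fun σ => spechtCharacter_of_parts_eq_two_cons_replicate_one μ₂ (by omega) hμ₂ σ
  have hmem₁ : spechtCharacter ℂ μ₁ ∈ fourTermClassFunctions n := by rw [hcol]; exact sign_mem
  have hmem₂ : spechtCharacter ℂ μ₂ ∈ fourTermClassFunctions n := by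
    rw [hhook]; exact signMulFixSubOne_mem
  constructor
  · intro hmem
    by_contra hne
    push Not at hne
    have hne1 : lam ≠ μ₁ := fun h => hne.1 (by rw [h, hμ₁])
    have hne2 : lam ≠ μ₂ := fun h => hne.2 (by rw [h, hμ₂])
    have hne12 : μ₁ ≠ μ₂ := by
      intro h
      have h2 : (2 : ℕ) ∈ μ₁.parts := by rw [h, hμ₂]; exact Multiset.mem_cons_self _ _
      rw [hμ₁] at h2
      have := Multiset.eq_of_mem_replicate h2
      omega
    -- three independent irreducible characters inside the `2`-dimensional `C_n`
    let ι : Fin 3 → Nat.Partition n := ![lam, μ₁, μ₂]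
    have hι : Function.Injective ι := by
      intro s t hst
      fin_cases s <;> fin_cases t <;>
        simp [ι, hne1, hne2, hne12, hne1.symm, hne2.symm, hne12.symm] at hst ⊢
    have hmem' : ∀ t, spechtCharacter ℂ (ι t) ∈ fourTermClassFunctions n := by
      intro t
      fin_cases t
      · exact hmem
      · exact hmem₁
      · exact hmem₂
    have hv : LinearIndependent ℂ (fun t => (⟨spechtCharacter ℂ (ι t), hmem' t⟩ : fourTermClassFunctions n)) := by
      refine LinearIndependent.of_comp (fourTermClassFunctions n).subtype ?_
      exact (Literature.NumberTheory.DiophantineGeometry.linearIndependent_spechtCharacter ℂ).comp ι hι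
    have := hv.fintype_card_le_finrank
    rw [finrank_fourTermClassFunctions hn, Fintype.card_fin] at this
    omega
  · rintro (h | h)
    · rw [show lam = μ₁ from Nat.Partition.ext (h.trans hμ₁.symm)]; exact hmem₁
    · rw [show lam = μ₂ from Nat.Partition.ext (h.trans hμ₂.symm)]; exact hmem₂

end Dimension

end Literature.RepresentationTheory.FiniteGroups

end
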